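import Literature.NumberTheory.EllipticCurves.IntSeriesValueNormRigidity
import Literature.NumberTheory.EllipticCurves.BurungaleKobayashiNakamuraOta2026.RubinPadicLFunctionValuesProofs
import HarnessLib

/-!
# Units of `𝒪_{ℂ_p}⟦T⟧` are detected by ONE value; one-point rigidity of divisibilities
# (`A ∣ B`, `‖A(x)‖ = ‖B(x)‖ ≠ 0` at one interior point ⟹ `(A) = (B)`)

Topic `NumberTheory/EllipticCurves`, namespace `Literature.NumberTheory.EllipticCurves.IntSeries` (THEOREMS ONLY: no definition,
no named fact, no `sorry`). Currency: the tree's `IntSeries.HasValueAt Q x v` (`= HasSum (k ↦ [T^k]Q · x^k) v` in `ℂ_p`,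
`Q : PowerSeries (PadicComplexInt p)`), the value predicate of every `p`-adic `L`-function frame of the BSD cells
(`IsBDPLFunction(Int)`, `IsHsiehLFunction`, `KatzCM.IsBaseChangeLine`, `RubinPadicLFunctionData`, …).

The tree already has the ring structure of evaluation on the open unit disc (`HasValueAt.add/sub/mul/pow/const_mul`,
`hasValueAt_C/one/X`, `hasValueAt_zero` = the value at the origin is `[T⁰]Q`; de Shalit / Katz-measure files), existence
and integrality of values (`exists_hasValueAt`, `norm_le_one_of_hasValueAt`) and the ultrametric transfer
`‖Q(x) − Q(0)‖ ≤ ‖x‖` (`norm_sub_constantCoeff_le`, `norm_constantCoeff_eq_of_lt`). This file adds the two standard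
consequences that the cells' "divisibility ⇒ equality" arguments need and that were not in the tree:

* §1 ★ `isUnit_iff_norm_value_eq_one` — `F ∈ 𝒪_{ℂ_p}⟦T⟧ˣ ⟺ ‖F(x)‖ = 1` at ONE (equivalently every) point `‖x‖ < 1`
  (Washington §7.1: `F` is a unit iff `F(0) ∈ 𝒪ˣ`; and `‖F(x) − F(0)‖ ≤ ‖x‖ < 1`); `norm_value_lt_one_of_not_isUnit`.
* §2 ★ ONE-POINT RIGIDITY — if `A ∣ B` in `𝒪_{ℂ_p}⟦T⟧` and at one point `‖x‖ < 1` the values satisfy `‖A(x)‖ = ‖B(x)‖`,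
  `B(x) ≠ 0`, then `B = A·U` with `U` a unit (`exists_isUnit_mul_eq_of_dvd_of_norm_value_eq`), so `B ∣ A`
  (`dvd_of_dvd_of_norm_value_eq`), `(A) = (B)` (`span_singleton_eq_of_dvd_of_norm_value_eq`) and every containment
  `J ≤ (A)` transfers to `J ≤ (B)` and back (`le_span_singleton_iff_of_dvd_of_norm_value_eq`); in general
  `‖B(x)‖ ≤ ‖A(x)‖` (`norm_value_le_of_dvd`) and a STRICT drop certifies a non-unit cofactor
  (`not_isUnit_of_dvd_of_norm_value_lt`). This is the algebra behind «a divisibility of Iwasawa functions plus ONE exact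
  special-value formula is an equality of ideals» (one-sided main-conjecture divisibility + the exact formula at one
  character), recorded as the "algebra note" of the BED lead on crux stmt-BirchSwinnertonDyer-21341
  (`Cruxes/EisensteinHeartFlatCMInertBadKPrime/LEAD-G5-VERDICT.md` §2b) — made kernel-exact and frame-free here.

[cite: Washington1997, §7.1 (units of `Λ = 𝒪⟦T⟧`)] [cite: Gouvea1993PadicNumbers, §5.6]
-/

noncomputable section

open scoped Classical
open Filter Topology PowerSeries Finset

namespace Literature.NumberTheory.EllipticCurves.IntSeries

variable {p : ℕ} [Fact p.Prime]

/-! ### §0. Two bookkeeping lemmas on values -/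

/-- Values are compatible with negation: `(−Q)(x) = −Q(x)`. [cite: Gouvea1993PadicNumbers, §5.6] -/
theorem HasValueAt.neg {Q : PowerSeries (PadicComplexInt p)} {x v : ℂ_[p]}
    (h : IntSeries.HasValueAt Q x v) : IntSeries.HasValueAt (-Q) x (-v) := by
  unfold IntSeries.HasValueAt at *
  refine (HasSum.neg h).congr_fun fun k => ?_
  rw [map_neg]
  push_cast
  ring

/-- The value of a product, read against given values of the factors: if `(F·G)(x) = u`, `F(x) = v`, `G(x) = w`
(`‖x‖ < 1`) then `u = v·w` (uniqueness of values + `HasValueAt.mul`). [cite: Gouvea1993PadicNumbers, §5.6] -/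
theorem value_mul_eq {F G : PowerSeries (PadicComplexInt p)} {x u v w : ℂ_[p]} (hx : ‖x‖ < 1)
    (hFG : IntSeries.HasValueAt (F * G) x u) (hF : IntSeries.HasValueAt F x v) (hG : IntSeries.HasValueAt G x w) :
    u = v * w :=
  hFG.unique (hF.mul hx hG)

/-! ### §1. Units are detected by one value -/

/-- A unit of `𝒪_{ℂ_p}⟦T⟧` has values of norm `1` everywhere on the open unit disc (`F·F⁻¹ = 1` gives
`F(x)·F⁻¹(x) = 1` with both factors of norm `≤ 1`). [cite: Washington1997, §7.1] -/
theorem norm_value_eq_one_of_isUnit {F : PowerSeries (PadicComplexInt p)} {x v : ℂ_[p]} (hx : ‖x‖ < 1)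
    (hF : IsUnit F) (hv : IntSeries.HasValueAt F x v) : ‖v‖ = 1 := by
  obtain ⟨u, rfl⟩ := hF
  obtain ⟨w, hw⟩ :=
    exists_hasValueAt ((u⁻¹ : (PowerSeries (PadicComplexInt p))ˣ) : PowerSeries (PadicComplexInt p)) hx
  have h1 : IntSeries.HasValueAt ((u : PowerSeries (PadicComplexInt p)) *
      ((u⁻¹ : (PowerSeries (PadicComplexInt p))ˣ) : PowerSeries (PadicComplexInt p))) x (v * w) := hv.mul hx hw
  rw [Units.mul_inv] at h1
  have hone : IntSeries.HasValueAt (1 : PowerSeries (PadicComplexInt p)) x 1 := by simpa using hv.pow hx 0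
  have hvw : v * w = 1 := h1.unique hone
  have hv1 : ‖v‖ ≤ 1 := norm_le_one_of_hasValueAt hv hx.le
  have hw1 : ‖w‖ ≤ 1 := norm_le_one_of_hasValueAt hw hx.le
  have hprod : ‖v‖ * ‖w‖ = 1 := by rw [← norm_mul, hvw, norm_one]
  by_contra hne
  have hlt : ‖v‖ < 1 := lt_of_le_of_ne hv1 hne
  have hlt' : ‖v‖ * ‖w‖ < 1 :=
    calc ‖v‖ * ‖w‖ ≤ ‖v‖ * 1 := mul_le_mul_of_nonneg_left hw1 (norm_nonneg _)
      _ < 1 := by rw [mul_one]; exact hlt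
  exact (lt_irrefl (1 : ℝ)) (hprod ▸ hlt')

/-- ★ **One value of norm `1` makes `F` a unit**: if `‖x‖ < 1` and `‖F(x)‖ = 1` then `F ∈ 𝒪_{ℂ_p}⟦T⟧ˣ`. Indeed
`‖F(x) − F(0)‖ ≤ ‖x‖ < 1 = ‖F(x)‖` forces `‖F(0)‖ = 1`, i.e. `[T⁰]F ∈ 𝒪_{ℂ_p}ˣ`, i.e. `F` is a unit.
[cite: Washington1997, §7.1] -/
theorem isUnit_of_norm_value_eq_one {F : PowerSeries (PadicComplexInt p)} {x v : ℂ_[p]} (hx : ‖x‖ < 1)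
    (hv : IntSeries.HasValueAt F x v) (h1 : ‖v‖ = 1) : IsUnit F := by
  rw [PowerSeries.isUnit_iff_constantCoeff, isUnit_padicComplexInt_iff]
  exact norm_constantCoeff_eq_of_lt hv hx.le (h1 ▸ hx) ▸ h1

/-- ★ **Units are detected by one value**: for `‖x‖ < 1` and `F(x) = v`, `F` is a unit iff `‖v‖ = 1`.
[cite: Washington1997, §7.1] -/
theorem isUnit_iff_norm_value_eq_one {F : PowerSeries (PadicComplexInt p)} {x v : ℂ_[p]} (hx : ‖x‖ < 1)
    (hv : IntSeries.HasValueAt F x v) : IsUnit F ↔ ‖v‖ = 1 :=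
  ⟨fun hF ↦ norm_value_eq_one_of_isUnit hx hF hv, isUnit_of_norm_value_eq_one hx hv⟩

/-- A non-unit has ALL its values in the open unit disc: `¬ IsUnit F → ‖F(x)‖ < 1` (`‖x‖ < 1`).
[cite: Washington1997, §7.1] -/
theorem norm_value_lt_one_of_not_isUnit {F : PowerSeries (PadicComplexInt p)} {x v : ℂ_[p]} (hx : ‖x‖ < 1)
    (hv : IntSeries.HasValueAt F x v) (hF : ¬ IsUnit F) : ‖v‖ < 1 :=
  lt_of_le_of_ne (norm_le_one_of_hasValueAt hv hx.le) fun h ↦ hF (isUnit_of_norm_value_eq_one hx hv h)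

/-! ### §2. One-point rigidity of divisibilities -/

/-- **Divisibility decreases values**: `A ∣ B` in `𝒪_{ℂ_p}⟦T⟧` gives `‖B(x)‖ ≤ ‖A(x)‖` at every `‖x‖ < 1`
(`B = A·C`, `‖C(x)‖ ≤ 1`). [cite: Washington1997, §7.1] -/
theorem norm_value_le_of_dvd {A B : PowerSeries (PadicComplexInt p)} {x a b : ℂ_[p]} (hx : ‖x‖ < 1)
    (hAB : A ∣ B) (ha : IntSeries.HasValueAt A x a) (hb : IntSeries.HasValueAt B x b) : ‖b‖ ≤ ‖a‖ := by
  obtain ⟨C, rfl⟩ := hAB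
  obtain ⟨c, hc⟩ := exists_hasValueAt C hx
  rw [value_mul_eq hx hb ha hc, norm_mul]
  exact mul_le_of_le_one_right (norm_nonneg _) (norm_le_one_of_hasValueAt hc hx.le)

/-- A zero of `A` on the open disc is a zero of every multiple `B` of `A`. [cite: Washington1997, §7.1] -/
theorem value_eq_zero_of_dvd {A B : PowerSeries (PadicComplexInt p)} {x b : ℂ_[p]} (hx : ‖x‖ < 1)
    (hAB : A ∣ B) (ha : IntSeries.HasValueAt A x 0) (hb : IntSeries.HasValueAt B x b) : b = 0 := by
  have h := norm_value_le_of_dvd hx hAB ha hb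
  rw [norm_zero] at h
  exact norm_le_zero_iff.mp h

/-- ★ **One-point rigidity (unit form).** If `A ∣ B` in `𝒪_{ℂ_p}⟦T⟧` and at one point `‖x‖ < 1` the values
`A(x) = a`, `B(x) = b` satisfy `‖a‖ = ‖b‖` and `b ≠ 0`, then `B = A·U` for a UNIT `U` (the cofactor `C` has
`‖C(x)‖ = ‖b‖/‖a‖ = 1`). [cite: Washington1997, §7.1] -/
theorem exists_isUnit_mul_eq_of_dvd_of_norm_value_eq {A B : PowerSeries (PadicComplexInt p)} {x a b : ℂ_[p]}
    (hx : ‖x‖ < 1) (hAB : A ∣ B) (ha : IntSeries.HasValueAt A x a) (hb : IntSeries.HasValueAt B x b)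
    (hb0 : b ≠ 0) (hab : ‖a‖ = ‖b‖) : ∃ U : PowerSeries (PadicComplexInt p), IsUnit U ∧ B = A * U := by
  obtain ⟨C, rfl⟩ := hAB
  obtain ⟨c, hc⟩ := exists_hasValueAt C hx
  have hbac : b = a * c := value_mul_eq hx hb ha hc
  have ha0 : a ≠ 0 := by
    rintro rfl
    exact hb0 (by rw [hbac, zero_mul])
  have hc1 : ‖c‖ = 1 := by
    have h : ‖a‖ * ‖c‖ = ‖a‖ * 1 := by rw [← norm_mul, ← hbac, mul_one, hab]
    exact mul_left_cancel₀ (norm_ne_zero_iff.mpr ha0) h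
  exact ⟨C, isUnit_of_norm_value_eq_one hx hc hc1, rfl⟩

/-- ★ **One-point rigidity (two-sided divisibility).** Under the same hypotheses `B ∣ A` as well.
[cite: Washington1997, §7.1] -/
theorem dvd_of_dvd_of_norm_value_eq {A B : PowerSeries (PadicComplexInt p)} {x a b : ℂ_[p]}
    (hx : ‖x‖ < 1) (hAB : A ∣ B) (ha : IntSeries.HasValueAt A x a) (hb : IntSeries.HasValueAt B x b)
    (hb0 : b ≠ 0) (hab : ‖a‖ = ‖b‖) : B ∣ A := by
  obtain ⟨U, hU, rfl⟩ := exists_isUnit_mul_eq_of_dvd_of_norm_value_eq hx hAB ha hb hb0 hab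
  obtain ⟨u, rfl⟩ := hU
  exact ⟨((u⁻¹ : (PowerSeries (PadicComplexInt p))ˣ) : PowerSeries (PadicComplexInt p)), by
    rw [mul_assoc, Units.mul_inv, mul_one]⟩

/-- ★ **One-point rigidity (ideal form).** If `A ∣ B` in `𝒪_{ℂ_p}⟦T⟧` and at one point `‖x‖ < 1` the values have
the same norm and `B(x) ≠ 0`, then `(A) = (B)`: a divisibility of Iwasawa functions that is an equality of norms at
ONE interior point is an equality of ideals. [cite: Washington1997, §7.1] -/
theorem span_singleton_eq_of_dvd_of_norm_value_eq {A B : PowerSeries (PadicComplexInt p)} {x a b : ℂ_[p]}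
    (hx : ‖x‖ < 1) (hAB : A ∣ B) (ha : IntSeries.HasValueAt A x a) (hb : IntSeries.HasValueAt B x b)
    (hb0 : b ≠ 0) (hab : ‖a‖ = ‖b‖) :
    Ideal.span ({A} : Set (PowerSeries (PadicComplexInt p))) = Ideal.span {B} :=
  le_antisymm (Ideal.span_singleton_le_span_singleton.mpr (dvd_of_dvd_of_norm_value_eq hx hAB ha hb hb0 hab))
    (Ideal.span_singleton_le_span_singleton.mpr hAB)

/-- **Transfer of containments** (the consumer shape of the BSD cells' "heart" statements `J ≤ (Q)`, e.g.
`∃ m, p^m · I · 𝒪⟦T⟧ ⊆ (Q)`): under the hypotheses of one-point rigidity, `J ≤ (A) ↔ J ≤ (B)` for every ideal `J`.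
[cite: Washington1997, §7.1] -/
theorem le_span_singleton_iff_of_dvd_of_norm_value_eq {A B : PowerSeries (PadicComplexInt p)} {x a b : ℂ_[p]}
    (hx : ‖x‖ < 1) (hAB : A ∣ B) (ha : IntSeries.HasValueAt A x a) (hb : IntSeries.HasValueAt B x b)
    (hb0 : b ≠ 0) (hab : ‖a‖ = ‖b‖) (J : Ideal (PowerSeries (PadicComplexInt p))) :
    J ≤ Ideal.span {A} ↔ J ≤ Ideal.span {B} := by
  rw [span_singleton_eq_of_dvd_of_norm_value_eq hx hAB ha hb hb0 hab]

/-- **Strict drop detects a non-unit cofactor**: if `A ∣ B`, `A(x) ≠ 0` and `‖B(x)‖ < ‖A(x)‖` at some `‖x‖ < 1`, then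
`B = A·C` with `C` a NON-unit (so `(B) < (A)` strictly whenever `A ≠ 0`). [cite: Washington1997, §7.1] -/
theorem not_isUnit_of_dvd_of_norm_value_lt {A C : PowerSeries (PadicComplexInt p)} {x a b : ℂ_[p]}
    (hx : ‖x‖ < 1) (ha : IntSeries.HasValueAt A x a) (hb : IntSeries.HasValueAt (A * C) x b)
    (hlt : ‖b‖ < ‖a‖) : ¬ IsUnit C := by
  intro hC
  obtain ⟨c, hc⟩ := exists_hasValueAt C hx
  have hc1 : ‖c‖ = 1 := norm_value_eq_one_of_isUnit hx hC hc
  have : ‖b‖ = ‖a‖ := by rw [value_mul_eq hx hb ha hc, norm_mul, hc1, mul_one]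
  exact (lt_irrefl _) (this ▸ hlt)

end Literature.NumberTheory.EllipticCurves.IntSeries

end
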